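import Literature.AlgebraicGeometry.Motives.AbelianVarietyFrobeniusKernelBlocks
import HarnessLib

/-!
# Block assembly of a kernel law: «`t ≫ F = 1 ↔ every block component is killed`», and a point-wise law holds iff it holds block by block
# ([MumfordAV1970] §19 (sums of endomorphisms act pointwise), §15 (p. 146: `F_{A∕k}` is natural); [SGA3I] VII_A 4.1)

Topic `Literature/AlgebraicGeometry/Motives`, namespace `Literature.AlgebraicGeometry.Motives.AbelianVariety`.  THEOREMS ONLY (no definition,
no named fact, no instance, no notation, no `sorry`).  Sequel of ★ `AbelianVarietyFrobeniusKernelBlocks` ((BLK-nat) naturality of «killed by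
`F^{(r)}_{A∕k}`» under endomorphisms; (BLK-sum) a point all of whose components `t ≫ ε_i` factor through a subgroup factors through it when
`Σ ε_i` fixes `t`).  Cell `hodgecm-mathlib` (D-0151), FLOOR 0, P6 «MOD programme» (crux hLiu418 = stmt-HodgeConjecture-24832), `stub_RGD`'s
Frobenius-kernel law (rL) of `Roof₀` («`t ≫ F_q = 1 ↔ ∀ a ∈ 𝔠, t ≫ ι(a) ≫ q̄ = 1`»), road of record (LEAD F0P6-plan (g2) 2026-09-01 20:54:42Z):
BLOCK-WISE — organ **(E2-asm) «BLOCK ASSEMBLY OF A KERNEL LAW»** (B-p18 (g37)).  HC_CM is proved only modulo the printed citations until rung 0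
closes; this file is generic and changes no count.

THE MATHEMATICS.  `A` an abelian variety over a field `k` of exponential characteristic `p`, `t` a `T`-point of `A`, `ε_i` (`i ∈ s`) endomorphisms
of `A` whose sum FIXES `t` (`t ≫ Σ ε_i = t`; e.g. `t` a point of `A[q]` and the `ε_i = ι(e_i)` for CRT lifts `e_i` of the idempotents of
`𝒪 ⊗ ℤ∕q`, `Σ e_i ≡ 1 (mod q)`).  Then:
* §A (ANY cartesian monoidal category; ns `Literature.AlgebraicGeometry.Motives`) **`comp_eq_one_of_forall_comp`** («components killed + `∏ uᵢ`
  fixes `t` ⇒ `t` killed», kernel of the monoid hom `x ↦ x ≫ f`), **`comp_eq_one_iff_forall_comp`** (with `uᵢ ≫ f = f ≫ u′ᵢ`),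
  **`forall_comp_comp_eq_one_iff`** (a family `t ≫ φ ≫ q = 1`, `φ ∈ Φ` stable under `uᵢ ≫ ·`), **`comp_eq_one_iff_forall_of_blocks`** (assembly).
* §B (ring-action shape, the call shape of GEN A-p18 (g30) `CENSUS-RGD-ASSEMBLY.v1` row (E2-asm)) **`comp_eq_one_iff_forall_block`**
  (`β : O → End G` additive, `β 1 = 𝟙`, `Σ eᵢ = 1`, `β(eᵢ) ≫ f = f ≫ β′(eᵢ)` ⇒ `t ≫ f = 1 ↔ ∀ i, (t ≫ β(eᵢ)) ≫ f = 1`) and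
  **`comp_eq_one_iff_forall_block_of_torsion`** (`[N]_G = 1`, `Σ eᵢ = 1 + N•c`); `map_sum_eq_prod`.
* §1 **`comp_relFrobenius_eq_one_iff_forall_comp`** — `t` is killed by `F^{(r)}_{A∕k}` iff every component `t ≫ ε_i` is (→ (BLK-nat): endomorphisms
  preserve «killed by `F`»; ← (BLK-sum) with the subgroup `Ker F^{(r)}_{A∕k} ↪ A`).
* §2 **`forall_comp_comp_eq_one_iff_forall_comp`** — for a homomorphism `q : A → Y` of `k`-group schemes and a set `Φ` of endomorphisms of `A`
  STABLE under `φ ↦ ε_i ≫ φ` (an IDEAL read through a ring action: `ι(e_i) ≫ ι(a) = ι(e_i a)` or `ι(a e_i)`): `t ≫ φ ≫ q = 1` for all `φ ∈ Φ` iff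
  `(t ≫ ε_i) ≫ φ ≫ q = 1` for all `i` and all `φ ∈ Φ` (→ stability; ← (BLK-sum) with the subgroup `Ker (φ ≫ q) ↪ A`).
* §3 **`comp_relFrobenius_eq_one_iff_of_blocks`** — THE ASSEMBLY: if for every block the law holds on the component,
  `(t ≫ ε_i) ≫ F = 1 ↔ ∀ φ ∈ Φ, (t ≫ ε_i) ≫ φ ≫ q = 1`, then it holds for `t`: `t ≫ F = 1 ↔ ∀ φ ∈ Φ, t ≫ φ ≫ q = 1`.
No idempotency or orthogonality of the `ε_i` is needed — only that their sum fixes the point.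

## References
* [MumfordAV1970] D. Mumford, *Abelian Varieties* (1970), §19 (first paragraph: `Hom(X, Y)`, addition is pointwise), §15 (p. 146: `F_{A∕k}`).
* [SGA3I] M. Demazure, A. Grothendieck (eds.), *SGA 3, Tome I*, Exp. VII_A §4, 4.1 (functoriality of the relative Frobenius).
* [GortzWedhorn2020] U. Görtz, T. Wedhorn, *Algebraic Geometry I* (2nd ed. 2020), Definition 4.45 (2) (p. 117) (kernels).
* [Tate1967] J. Tate, *p-divisible groups* (1967), §2.2 (endomorphisms of the layers, ring actions).
-/

set_option autoImplicit false

universe v u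

open CategoryTheory Limits MonoidalCategory CartesianMonoidalCategory AlgebraicGeometry

noncomputable section

namespace Literature.AlgebraicGeometry.Motives

open Literature.AlgebraicGeometry.GroupSchemes Literature.AlgebraicGeometry.GroupSchemes.GroupSchemeKernel
open scoped MonObj Obj


/-! ## §A Block decomposition of «`t ≫ f = 1`» in a cartesian monoidal category (group objects, pointwise products of `T`-points) -/

section Categorical

variable {C : Type u} [Category.{v} C] [CartesianMonoidalCategory C] [BraidedCategory C] {G G' T : C} [GrpObj G] [IsCommMonObj G] [GrpObj G']
  (f : G ⟶ G') [IsMonHom f] {J : Type*} (s : Finset J) (u : J → (G ⟶ G)) (t : T ⟶ G)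

/-- Precomposition with `t` is a monoid homomorphism `(G ⟶ G) → (T ⟶ G)` for the pointwise products (Mathlib `MonObj.comp_mul`), hence
commutes with finite products: `t ≫ ∏ uᵢ = ∏ (t ≫ uᵢ)`. [cite: MumfordAV1970, §19 (first paragraph)] -/
theorem comp_prod_eq_prod_comp : t ≫ (∏ i ∈ s, u i) = ∏ i ∈ s, (t ≫ u i) :=
  map_prod (MonoidHom.mk' (fun x : G ⟶ G => t ≫ x) (MonObj.comp_mul t)) u s

/-- **If every block component `t ≫ uᵢ` is killed by the homomorphism `f` and `∏ uᵢ` fixes `t`, then `t` is killed by `f`**: `t = ∏ (t ≫ uᵢ)`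
is a product of elements of the kernel of the monoid homomorphism `x ↦ x ≫ f` (Mathlib `IsMonHom.monoidHom`). No commutativity of `G′`,
no idempotency of the `uᵢ`. [cite: MumfordAV1970, §19 (first paragraph)] -/
theorem comp_eq_one_of_forall_comp (hfix : t ≫ (∏ i ∈ s, u i) = t) (h : ∀ i ∈ s, (t ≫ u i) ≫ f = 1) : t ≫ f = 1 := by
  rw [← hfix, comp_prod_eq_prod_comp s u t]
  have hmem : (∏ i ∈ s, (t ≫ u i)) ∈ MonoidHom.mker (IsMonHom.monoidHom f T) :=
    prod_mem fun i hi => (MonoidHom.mem_mker).mpr (h i hi)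
  exact (MonoidHom.mem_mker).mp hmem

/-- **«`t ≫ f = 1` ↔ every block component is killed by `f`»** for a homomorphism `f : G → G′` INTERTWINING the block operators
(`uᵢ ≫ f = f ≫ u′ᵢ` with `u′ᵢ` homomorphisms — e.g. `f` equivariant for a ring action on both sides, or `f` the relative Frobenius and
`u′ᵢ = uᵢ^{(q)}`), `∏ uᵢ` fixing `t`. [cite: MumfordAV1970, §19 (first paragraph)] [cite: SGA3I, VII_A 4.1] -/
theorem comp_eq_one_iff_forall_comp (u' : J → (G' ⟶ G')) [∀ i, IsMonHom (u' i)] (hf : ∀ i ∈ s, u i ≫ f = f ≫ u' i)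
    (hfix : t ≫ (∏ i ∈ s, u i) = t) : t ≫ f = 1 ↔ ∀ i ∈ s, (t ≫ u i) ≫ f = 1 := by
  refine ⟨fun ht i hi => ?_, comp_eq_one_of_forall_comp f s u t hfix⟩
  rw [Category.assoc, hf i hi, ← Category.assoc, ht, MonObj.one_comp]

/-- **A family of conditions «`t ≫ φ ≫ q = 1`, `φ ∈ Φ`» is decided block by block** when `Φ` is stable under `φ ↦ uᵢ ≫ φ` (an IDEAL read
through a ring action) and the `φ ∈ Φ` and `q` are homomorphisms. [cite: MumfordAV1970, §19 (first paragraph)] -/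
theorem forall_comp_comp_eq_one_iff {G'' : C} [GrpObj G''] (q : G ⟶ G'') [IsMonHom q] (Φ : Set (G ⟶ G)) [∀ φ : Φ, IsMonHom (φ : G ⟶ G)]
    (hΦ : ∀ i ∈ s, ∀ φ ∈ Φ, u i ≫ φ ∈ Φ) (hfix : t ≫ (∏ i ∈ s, u i) = t) :
    (∀ φ ∈ Φ, t ≫ φ ≫ q = 1) ↔ ∀ i ∈ s, ∀ φ ∈ Φ, (t ≫ u i) ≫ φ ≫ q = 1 := by
  refine ⟨fun h i hi φ hφ => ?_, fun h φ hφ => ?_⟩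
  · rw [Category.assoc, ← Category.assoc (u i)]
    exact h _ (hΦ i hi φ hφ)
  · haveI : IsMonHom φ := inferInstanceAs (IsMonHom ((⟨φ, hφ⟩ : Φ) : G ⟶ G))
    exact comp_eq_one_of_forall_comp (φ ≫ q) s u t hfix (fun i hi => h i hi φ hφ)

/-- **BLOCK ASSEMBLY OF A KERNEL LAW (categorical form).**  If on every block the law «killed by `f` ↔ killed by every `φ ≫ q`, `φ ∈ Φ`»
holds for the component `t ≫ uᵢ`, then it holds for `t`. [cite: MumfordAV1970, §19 (first paragraph)] [cite: SGA3I, VII_A 4.1] -/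
theorem comp_eq_one_iff_forall_of_blocks (u' : J → (G' ⟶ G')) [∀ i, IsMonHom (u' i)] (hf : ∀ i ∈ s, u i ≫ f = f ≫ u' i)
    {G'' : C} [GrpObj G''] (q : G ⟶ G'') [IsMonHom q] (Φ : Set (G ⟶ G)) [∀ φ : Φ, IsMonHom (φ : G ⟶ G)]
    (hΦ : ∀ i ∈ s, ∀ φ ∈ Φ, u i ≫ φ ∈ Φ) (hfix : t ≫ (∏ i ∈ s, u i) = t)
    (law : ∀ i ∈ s, ((t ≫ u i) ≫ f = 1 ↔ ∀ φ ∈ Φ, (t ≫ u i) ≫ φ ≫ q = 1)) :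
    t ≫ f = 1 ↔ ∀ φ ∈ Φ, t ≫ φ ≫ q = 1 := by
  rw [comp_eq_one_iff_forall_comp f s u t u' hf hfix, forall_comp_comp_eq_one_iff s u t q Φ hΦ hfix]
  exact ⟨fun h i hi => (law i hi).mp (h i hi), fun h i hi => (law i hi).mpr (h i hi)⟩

end Categorical

/-! ## §B The ring-action shape (CRT idempotents `eᵢ` with `Σ eᵢ = 1`, or `Σ eᵢ ≡ 1 (mod N)` on an `N`-torsion layer) -/

section RingAction

variable {C : Type u} [Category.{v} C] [CartesianMonoidalCategory C] [BraidedCategory C] {G G' T : C} [GrpObj G] [IsCommMonObj G] [GrpObj G']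
  (f : G ⟶ G') [IsMonHom f] {O : Type*} [CommRing O] (β : O → (G ⟶ G)) (β' : O → (G' ⟶ G')) [∀ a, IsMonHom (β' a)]
  (hβone : β 1 = 𝟙 G) (hβadd : ∀ a b, β (a + b) = β a * β b) {J : Type*} (s : Finset J) (e : J → O) (t : T ⟶ G)

include hβadd in
/-- An additive action turns sums into pointwise products: `β (Σ eᵢ) = ∏ β eᵢ` (given `β 0 = 1`, which follows from `β (0+0) = β 0 · β 0`).
[cite: Tate1967, §2.2] -/
theorem map_sum_eq_prod : β (∑ i ∈ s, e i) = ∏ i ∈ s, β (e i) := by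
  classical
  have h0 : β 0 = 1 := by
    have h := hβadd 0 0
    rw [add_zero] at h
    exact (mul_eq_left.mp h.symm)
  induction s using Finset.induction_on with
  | empty => rw [Finset.sum_empty, Finset.prod_empty, h0]
  | insert a s ha ih => rw [Finset.sum_insert ha, Finset.prod_insert ha, hβadd, ih]

include hβone hβadd in
/-- **«`t ≫ f = 1` ↔ every block component `t ≫ β(eᵢ)` is killed», RING-ACTION SHAPE**: `β : O → End(G)` additive with `β 1 = 𝟙`
(a ring action unbundled), `Σ eᵢ = 1` in `O` (CRT idempotents summed to one), `f` a homomorphism intertwining `β(eᵢ)` and `β′(eᵢ)`.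
The shape GEN A-p18 (g30) asked for (`CENSUS-RGD-ASSEMBLY.v1` row (E2-asm)), for every `T`-point `t`. [cite: Tate1967, §2.2]
[cite: MumfordAV1970, §19 (first paragraph)] -/
theorem comp_eq_one_iff_forall_block (he : ∑ i ∈ s, e i = 1) (hf : ∀ i ∈ s, β (e i) ≫ f = f ≫ β' (e i)) :
    t ≫ f = 1 ↔ ∀ i ∈ s, (t ≫ β (e i)) ≫ f = 1 := by
  refine comp_eq_one_iff_forall_comp f s (fun i => β (e i)) t (fun i => β' (e i)) hf ?_
  rw [← map_sum_eq_prod β hβadd s e, he, hβone, Category.comp_id]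

include hβone hβadd in
/-- **The same on an `N`-TORSION layer with idempotents only modulo `N`**: if `[N]_G = 1` (i.e. `(𝟙 G)^N = 1` pointwise — `G = A[N]`) and
`Σ eᵢ = 1 + N·c`, then `β(Σ eᵢ) = β 1 · (β c)^N = 𝟙`, so again `t ≫ f = 1 ↔ ∀ i, (t ≫ β(eᵢ)) ≫ f = 1`. [cite: Tate1967, §2.2]
[cite: MumfordAV1970, §19 (first paragraph)] -/
theorem comp_eq_one_iff_forall_block_of_torsion {N : ℕ} (hN : (𝟙 G) ^ N = 1) {c : O} (he : ∑ i ∈ s, e i = 1 + N • c)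
    (hf : ∀ i ∈ s, β (e i) ≫ f = f ≫ β' (e i)) :
    t ≫ f = 1 ↔ ∀ i ∈ s, (t ≫ β (e i)) ≫ f = 1 := by
  refine comp_eq_one_iff_forall_comp f s (fun i => β (e i)) t (fun i => β' (e i)) hf ?_
  have hβN : ∀ m : ℕ, β (m • c) = β c ^ m := by
    intro m
    induction m with
    | zero =>
      rw [zero_smul, pow_zero]
      have h := hβadd 0 0
      rw [add_zero] at h
      exact (mul_eq_left.mp h.symm)
    | succ n ih => rw [succ_nsmul, hβadd, ih, pow_succ]
  have hpow : β c ^ N = 1 := by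
    rw [← Category.comp_id (β c), ← MonObj.comp_pow, hN, MonObj.comp_one]
  rw [← map_sum_eq_prod β hβadd s e, he, hβadd, hβone, hβN N, hpow, mul_one, Category.comp_id]

end RingAction

namespace AbelianVariety

/-! ## §1 «Killed by Frobenius» is decided block by block (abelian varieties, via the subgroup `Ker F`) -/

section Frobenius

variable {k : Type u} [Field k] (p : ℕ) [ExpChar k p] (r : ℕ) (A : AbelianVariety k)
  {J : Type*} (s : Finset J) (ε : J → (A ⟶ A)) {T : SchemeOver k} (t : T ⟶ A.X)

/-- **«`t ≫ F^{(r)}_{A∕k} = 1` ↔ every block component `t ≫ ε_i` is killed by `F^{(r)}_{A∕k}`**, for endomorphisms `ε_i` whose sum fixes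
`t`.  (→) endomorphisms preserve «killed by `F`» (★ (BLK-nat) `comp_end_comp_relFrobenius_eq_one`); (←) every component factors through
the subgroup `Ker F^{(r)}_{A∕k} ↪ A` (★ `kerLift`), hence so does `t` (★ (BLK-sum) `exists_fac_of_comp_sum_eq`), and `ι_{Ker} ≫ F = 1`
(★ `kerι_comp`). [cite: MumfordAV1970, §15 (p. 146)] [cite: MumfordAV1970, §19 (first paragraph)] -/
theorem comp_relFrobenius_eq_one_iff_forall_comp (hsum : t ≫ (∑ i ∈ s, ε i).hom.hom.hom = t) :
    t ≫ (A.relFrobenius p r).hom.hom.hom = 1 ↔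
      ∀ i ∈ s, (t ≫ (ε i).hom.hom.hom) ≫ (A.relFrobenius p r).hom.hom.hom = 1 := by
  refine ⟨fun ht i _ => A.comp_end_comp_relFrobenius_eq_one p r (ε i) t ht, fun h => ?_⟩
  obtain ⟨u, hu⟩ := A.exists_fac_of_comp_sum_eq (kerι (A.relFrobenius p r).hom.hom.hom) t s ε hsum
    (fun i hi => ⟨kerLift _ (h i hi), kerLift_ι _ _⟩)
  rw [← hu, Category.assoc, kerι_comp, MonObj.comp_one]

end Frobenius

/-! ## §2 A point-wise vanishing condition over an ideal of endomorphisms is decided block by block -/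

section Ideal

variable {k : Type u} [Field k] (A : AbelianVariety k) {Y : SchemeOver k} [GrpObj Y] (q : A.X ⟶ Y) [IsMonHom q]
  {J : Type*} (s : Finset J) (ε : J → (A ⟶ A)) (Φ : Set (A ⟶ A)) {T : SchemeOver k} (t : T ⟶ A.X)

/-- **«`t ≫ φ ≫ q = 1` for all `φ ∈ Φ` ↔ `(t ≫ ε_i) ≫ φ ≫ q = 1` for all blocks `i` and all `φ ∈ Φ`**, for a homomorphism `q : A → Y` of
`k`-group schemes, endomorphisms `ε_i` whose sum fixes `t`, and a set `Φ` of endomorphisms stable under `φ ↦ ε_i ≫ φ` (an ideal `𝔠` read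
through a ring action `ι`, `ε_i = ι(e_i)`).  (→) stability; (←) for each `φ`, every component factors through `Ker (φ ≫ q) ↪ A`, hence so
does `t` (★ (BLK-sum)). [cite: MumfordAV1970, §19 (first paragraph)] [cite: GortzWedhorn2020, Definition 4.45 (2) (p. 117)] -/
theorem forall_comp_comp_eq_one_iff_forall_comp (hsum : t ≫ (∑ i ∈ s, ε i).hom.hom.hom = t)
    (hΦ : ∀ i ∈ s, ∀ φ ∈ Φ, ε i ≫ φ ∈ Φ) :
    (∀ φ ∈ Φ, t ≫ φ.hom.hom.hom ≫ q = 1) ↔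
      ∀ i ∈ s, ∀ φ ∈ Φ, (t ≫ (ε i).hom.hom.hom) ≫ φ.hom.hom.hom ≫ q = 1 := by
  refine ⟨fun h i hi φ hφ => ?_, fun h φ hφ => ?_⟩
  · have e : (t ≫ (ε i).hom.hom.hom) ≫ φ.hom.hom.hom ≫ q = t ≫ (ε i ≫ φ).hom.hom.hom ≫ q := by
      simp only [Category.assoc]
      rfl
    rw [e]
    exact h _ (hΦ i hi φ hφ)
  · haveI : IsMonHom (φ.hom.hom.hom ≫ q) := inferInstance
    obtain ⟨u, hu⟩ := A.exists_fac_of_comp_sum_eq (kerι (φ.hom.hom.hom ≫ q)) t s ε hsum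
      (fun i hi => ⟨kerLift _ (h i hi φ hφ), kerLift_ι _ _⟩)
    rw [← hu, Category.assoc, kerι_comp, MonObj.comp_one]

end Ideal

/-! ## §3 The assembly: per-block laws ⇒ the law -/

section Assembly

variable {k : Type u} [Field k] (p : ℕ) [ExpChar k p] (r : ℕ) (A : AbelianVariety k) {Y : SchemeOver k} [GrpObj Y]
  (q : A.X ⟶ Y) [IsMonHom q] {J : Type*} (s : Finset J) (ε : J → (A ⟶ A)) (Φ : Set (A ⟶ A)) {T : SchemeOver k} (t : T ⟶ A.X)

/-- **BLOCK ASSEMBLY OF A KERNEL LAW.**  Let `t` be a `T`-point of `A`, `ε_i` (`i ∈ s`) endomorphisms whose sum fixes `t`, `Φ` a set of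
endomorphisms stable under `φ ↦ ε_i ≫ φ`, and `q : A → Y` a homomorphism of `k`-group schemes.  If ON EVERY BLOCK the law «killed by
`F^{(r)}_{A∕k}` ↔ killed by every `φ ≫ q`, `φ ∈ Φ`» holds for the component `t ≫ ε_i`, then it holds for `t`:
`t ≫ F^{(r)}_{A∕k} = 1 ↔ ∀ φ ∈ Φ, t ≫ φ ≫ q = 1` (§1 + §2).  This is the assembly step of the block-wise road to `Roof₀`'s (rL): the
`ε_i = ι(e_i)` are the CRT idempotents of `𝒪 ∕ q` (connected `w`-block, étale `c•w`-block, banal blocks), `Φ = ι(𝔠)`, `q = q̄`.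
[cite: MumfordAV1970, §15 (p. 146)] [cite: MumfordAV1970, §19 (first paragraph)] [cite: SGA3I, VII_A 4.1] -/
theorem comp_relFrobenius_eq_one_iff_of_blocks (hsum : t ≫ (∑ i ∈ s, ε i).hom.hom.hom = t)
    (hΦ : ∀ i ∈ s, ∀ φ ∈ Φ, ε i ≫ φ ∈ Φ)
    (law : ∀ i ∈ s, ((t ≫ (ε i).hom.hom.hom) ≫ (A.relFrobenius p r).hom.hom.hom = 1 ↔
      ∀ φ ∈ Φ, (t ≫ (ε i).hom.hom.hom) ≫ φ.hom.hom.hom ≫ q = 1)) :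
    t ≫ (A.relFrobenius p r).hom.hom.hom = 1 ↔ ∀ φ ∈ Φ, t ≫ φ.hom.hom.hom ≫ q = 1 := by
  rw [A.comp_relFrobenius_eq_one_iff_forall_comp p r s ε t hsum, A.forall_comp_comp_eq_one_iff_forall_comp q s ε Φ t hsum hΦ]
  exact ⟨fun h i hi => (law i hi).mp (h i hi), fun h i hi => (law i hi).mpr (h i hi)⟩

/-- **The same with the per-block laws stated for points IN the blocks** (`x = x ≫ ε_i`-shaped hypotheses are not needed: the law is only
ever applied to the components `t ≫ ε_i`), recorded in the `∀`-over-points form a block supplier proves: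
`law_i : ∀ x : T ⟶ A.X, (x ≫ ε_i) ≫ F = 1 ↔ ∀ φ ∈ Φ, (x ≫ ε_i) ≫ φ ≫ q = 1`. [cite: MumfordAV1970, §15 (p. 146)] [cite: SGA3I, VII_A 4.1] -/
theorem comp_relFrobenius_eq_one_iff_of_blocks' (hsum : t ≫ (∑ i ∈ s, ε i).hom.hom.hom = t)
    (hΦ : ∀ i ∈ s, ∀ φ ∈ Φ, ε i ≫ φ ∈ Φ)
    (law : ∀ i ∈ s, ∀ x : T ⟶ A.X, ((x ≫ (ε i).hom.hom.hom) ≫ (A.relFrobenius p r).hom.hom.hom = 1 ↔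
      ∀ φ ∈ Φ, (x ≫ (ε i).hom.hom.hom) ≫ φ.hom.hom.hom ≫ q = 1)) :
    t ≫ (A.relFrobenius p r).hom.hom.hom = 1 ↔ ∀ φ ∈ Φ, t ≫ φ.hom.hom.hom ≫ q = 1 :=
  A.comp_relFrobenius_eq_one_iff_of_blocks p r q s ε Φ t hsum hΦ fun i hi => law i hi t

end Assembly

end AbelianVariety

end Literature.AlgebraicGeometry.Motives

end
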